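import Summits.QuantumFields.YangMills.Theorems.SwapVirialDeficitZeroModeSigmaFourSmallBallTaylor
import Summits.QuantumFields.YangMills.Theorems.WeakCouplingRatesColdBoxCubic
import HarnessLib

/-!
# Exact zero-mode rung Z5 — toward the POWER RATE of the σ-twisted four-leader small ball, measure side IV: where a flip can live
# (free-hands support of ⟨stmt-QuantumFields-24197⟩; split with w3 g63: deterministic Taylor package ✓`…SmallBallTaylor`, measure side w2 g56)

A point `w = ((x,y),z)` of the symmetric difference `rescaledSigmaR r s A Δ limSigma r A` ("a flip") lies, off the null set `{x̄ = 0} ∪ {ȳ = 0} ∪ {z₀ = 0}`,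
in one of finitely many COORDINATE regions whose dominator mass is small (parts III, V) or in the Taylor shell of part I/VII:
* §I ★ `not_mem_rescaledSigmaR_of_neg` — the QUANTITATIVE exclusion for `z₀ < 0`: if `s(a+b+c) ≤ 1/4` and `rs < 1` then `w ∉ rescaledSigmaR r s A`
  (`‖M₃(0)‖ = 2`, `‖L₃‖ ≤ 2a + c`, ✓`norm_Mrel_sub_le`);
* §J ★★ `flip_cases` — for `x̄, ȳ ≠ 0`, `z₀ ≠ 0`, `0 < s`, `rs < 1`, `sR₀ ≤ 1/4`: a flip has LARGE RATIOS `a+b+c > R₀`, or lies in one of the three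
  BALL-FLIP LAYERS `1 − s²‖x_⊥‖² ≤ ‖x̄‖² < 1` (resp. `y`, `z`), or in the SHELL `limSigma (r + 8sR₀²) A \ limSigma (r − 8sR₀²) A` (✓`mem_shell_of_flip_taylor`);
* §K coordinates: `norm_axPart_sq` … (✓`WeakCouplingRates.sq_norm_im`), `trRatio_large` (`a > T'` ⇒ `‖x̄‖ < ε` or `‖x_⊥‖² > T'²ε²`), `imRatio_large`, and ★★ `flip_subset` — the symmetric
  difference is contained in NULL ∪ (eight coordinate cuts ∩ (event ∪ limit)) ∪ SHELL.
HONEST LABEL: finite-dimensional real analysis (plan-level zero-mode rung of a DRAFT line «sharp-sigma»); NOT the fixed-`L` sharp law, NOT ⟨24197⟩; the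
Yang–Mills mass gap is NOT proved; no summit is proved by a line.  Width seat ym-line-sfw-p2-w2 g56 (cell ym-idea-1, free hands; own crux ⟨22884⟩ blocked-on ⟨19935⟩),
`--supports stmt-QuantumFields-24197`.  THEOREMS ONLY, standard axioms, 0 `sorry`.  References: [cite: Luscher1983, §2]; [cite: Vanbaal2001]; [folklore].
-/

set_option autoImplicit false

noncomputable section

open MeasureTheory Quaternion Set Filter Topology
open scoped Quaternion ENNReal BigOperators
open Literature.MathematicalPhysics.QuantumLattice
open Literature.Analysis.Calculus (radialUnit radialUnit_def norm_radialUnit)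
open Summit.QuantumFields.YangMills.Theorems.SwapTwistDeficit.ToronLog
open Summit.QuantumFields.YangMills.Theorems.SwapVirialDeficit.ZeroModeGroup

namespace Summit.QuantumFields.YangMills.Theorems.SwapVirialDeficit.ZeroModeSigma

/-! ## §I The quantitative exclusion for `z₀ < 0` -/

/-- `‖L₃‖ ≤ 2a + c` (`L₃ = A·Wd − Xd·A`, `‖A‖ = 1`). [folklore] -/
theorem norm_Lrel_three_le {A : ℍ} (hA : ‖A‖ = 1) (x y z : ℍ) : ‖Lrel A x y z 3‖ ≤ 2 * trRatio x + imRatio z := by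
  have e : Lrel A x y z 3 = A * Wd A x z - Xd x * A := rfl
  rw [e]
  calc ‖A * Wd A x z - Xd x * A‖ ≤ ‖A * Wd A x z‖ + ‖Xd x * A‖ := norm_sub_le _ _
    _ ≤ ‖A‖ * ‖Wd A x z‖ + ‖Xd x‖ * ‖A‖ := add_le_add (norm_mul_le _ _) (norm_mul_le _ _)
    _ = ‖Wd A x z‖ + ‖Xd x‖ := by rw [hA, one_mul, mul_one]
    _ ≤ (trRatio x + imRatio z) + trRatio x := add_le_add (norm_Wd_le hA x z) (norm_Xd x).le
    _ = 2 * trRatio x + imRatio z := by ring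

/-- ★ **Quantitative exclusion for `z₀ < 0`**: with `x̄, ȳ ≠ 0`, `0 ≤ s`, `s(a+b+c) ≤ 1/4` and `rs < 1`, the point is NOT in the rescaled event
(`‖M₃(s)‖ ≥ 2 − 2s(a+b+c) − 8s²(a+b+c)² ≥ 1 > rs`). [folklore] -/
theorem not_mem_rescaledSigmaR_of_neg {r s : ℝ} {A : ℍ} (hA : ‖A‖ = 1) (hJ : A.imJ = 0) (hK : A.imK = 0) {w : (ℍ × ℍ) × ℍ}
    (hx : axPart w.1.1 ≠ 0) (hy : axPart w.1.2 ≠ 0) (hz : w.2.re < 0) (hs : 0 ≤ s)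
    (hsρ : s * (trRatio w.1.1 + trRatio w.1.2 + imRatio w.2) ≤ 1 / 4) (hrs : r * s < 1) : w ∉ rescaledSigmaR r s A := by
  intro hmem
  have h3 : ‖Mrel A w.1.1 w.1.2 w.2 3 s‖ ≤ r * s := ((mem_rescaledSigmaR_iff r s A w).1 hmem).1 3
  obtain ⟨ha, hc⟩ := ratios_nonneg w.1.1 w.2
  have hb := (ratios_nonneg w.1.2 w.2).1
  have hρ0 : 0 ≤ trRatio w.1.1 + trRatio w.1.2 + imRatio w.2 := by positivity
  have hT := norm_Mrel_sub_le hA hx hy hz.ne hs (by linarith) 3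
  have h0 : ‖Mrel A w.1.1 w.1.2 w.2 3 0‖ = 2 := norm_Mrel_three_zero_of_neg hA hJ hK hx w.1.2 hz
  have hL : ‖Lrel A w.1.1 w.1.2 w.2 3‖ ≤ 2 * (trRatio w.1.1 + trRatio w.1.2 + imRatio w.2) :=
    (norm_Lrel_three_le hA w.1.1 w.1.2 w.2).trans (by linarith)
  have key : ‖Mrel A w.1.1 w.1.2 w.2 3 0‖ ≤ ‖Mrel A w.1.1 w.1.2 w.2 3 s‖ +
      ‖Mrel A w.1.1 w.1.2 w.2 3 s - Mrel A w.1.1 w.1.2 w.2 3 0 - s • Lrel A w.1.1 w.1.2 w.2 3‖ + s * ‖Lrel A w.1.1 w.1.2 w.2 3‖ := by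
    have e : Mrel A w.1.1 w.1.2 w.2 3 0 = Mrel A w.1.1 w.1.2 w.2 3 s -
        (Mrel A w.1.1 w.1.2 w.2 3 s - Mrel A w.1.1 w.1.2 w.2 3 0 - s • Lrel A w.1.1 w.1.2 w.2 3) - s • Lrel A w.1.1 w.1.2 w.2 3 := by abel
    calc ‖Mrel A w.1.1 w.1.2 w.2 3 0‖
        = ‖Mrel A w.1.1 w.1.2 w.2 3 s - (Mrel A w.1.1 w.1.2 w.2 3 s - Mrel A w.1.1 w.1.2 w.2 3 0 - s • Lrel A w.1.1 w.1.2 w.2 3) -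
            s • Lrel A w.1.1 w.1.2 w.2 3‖ := by rw [← e]
      _ ≤ ‖Mrel A w.1.1 w.1.2 w.2 3 s - (Mrel A w.1.1 w.1.2 w.2 3 s - Mrel A w.1.1 w.1.2 w.2 3 0 - s • Lrel A w.1.1 w.1.2 w.2 3)‖ +
            ‖s • Lrel A w.1.1 w.1.2 w.2 3‖ := norm_sub_le _ _
      _ ≤ ‖Mrel A w.1.1 w.1.2 w.2 3 s‖ + ‖Mrel A w.1.1 w.1.2 w.2 3 s - Mrel A w.1.1 w.1.2 w.2 3 0 - s • Lrel A w.1.1 w.1.2 w.2 3‖ +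
            s * ‖Lrel A w.1.1 w.1.2 w.2 3‖ := by
          rw [norm_smul, Real.norm_eq_abs, abs_of_nonneg hs]
          linarith [norm_sub_le (Mrel A w.1.1 w.1.2 w.2 3 s) (Mrel A w.1.1 w.1.2 w.2 3 s - Mrel A w.1.1 w.1.2 w.2 3 0 - s • Lrel A w.1.1 w.1.2 w.2 3)]
  have hsρ2 : (s * (trRatio w.1.1 + trRatio w.1.2 + imRatio w.2)) ^ 2 ≤ 1 / 16 := by nlinarith [mul_nonneg hs hρ0]
  have hsL : s * ‖Lrel A w.1.1 w.1.2 w.2 3‖ ≤ 1 / 2 := by nlinarith [mul_le_mul_of_nonneg_left hL hs]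
  nlinarith [mul_nonneg hs hρ0]

/-! ## §J The flip decomposition -/

/-- Off the layer `1 − s²T ≤ N < 1` the ball agreement hypothesis holds: `N + s²T < 1 ∨ 1 ≤ N`. [folklore] -/
theorem ball_hyp_of_not_layer {s N T : ℝ} (h : ¬ (1 - s ^ 2 * T ≤ N ∧ N < 1)) : N + s ^ 2 * T < 1 ∨ 1 ≤ N := by
  by_cases hN : N < 1
  · left
    have : ¬ (1 - s ^ 2 * T ≤ N) := fun h' => h ⟨h', hN⟩
    linarith [not_le.1 this]
  · exact Or.inr (not_lt.1 hN)

/-- ★★ **WHERE A FLIP CAN LIVE**: for an axial unit hub `A`, `x̄, ȳ ≠ 0`, `z₀ ≠ 0`, `0 < s`, `rs < 1`, `sR₀ ≤ 1/4`, a disagreement between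
`w ∈ rescaledSigmaR r s A` and `w ∈ limSigma r A` forces: the ratios are large (`a+b+c > R₀`), or `w` lies in one of the three ball-flip layers, or in
the Taylor shell `limSigma (r + 8sR₀²) A \ limSigma (r − 8sR₀²) A`. [folklore] -/
theorem flip_cases {r s R₀ : ℝ} {A : ℍ} (hA : ‖A‖ = 1) (hJ : A.imJ = 0) (hK : A.imK = 0) (hs : 0 < s) (hrs : r * s < 1)
    (hR : s * R₀ ≤ 1 / 4) {w : (ℍ × ℍ) × ℍ} (hx : axPart w.1.1 ≠ 0) (hy : axPart w.1.2 ≠ 0) (hz : w.2.re ≠ 0)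
    (hflip : ¬ (w ∈ rescaledSigmaR r s A ↔ w ∈ limSigma r A)) :
    R₀ < trRatio w.1.1 + trRatio w.1.2 + imRatio w.2 ∨
    (1 - s ^ 2 * ‖trPart w.1.1‖ ^ 2 ≤ ‖axPart w.1.1‖ ^ 2 ∧ ‖axPart w.1.1‖ ^ 2 < 1) ∨
    (1 - s ^ 2 * ‖trPart w.1.2‖ ^ 2 ≤ ‖axPart w.1.2‖ ^ 2 ∧ ‖axPart w.1.2‖ ^ 2 < 1) ∨
    (1 - s ^ 2 * ‖w.2.im‖ ^ 2 ≤ ‖(w.2.re : ℍ)‖ ^ 2 ∧ ‖(w.2.re : ℍ)‖ ^ 2 < 1) ∨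
    w ∈ limSigma (r + 8 * s * R₀ ^ 2) A \ limSigma (r - 8 * s * R₀ ^ 2) A := by
  by_cases hρ : R₀ < trRatio w.1.1 + trRatio w.1.2 + imRatio w.2
  · exact Or.inl hρ
  right
  have hρ' : trRatio w.1.1 + trRatio w.1.2 + imRatio w.2 ≤ R₀ := not_lt.1 hρ
  obtain ⟨ha, hc⟩ := ratios_nonneg w.1.1 w.2
  have hb := (ratios_nonneg w.1.2 w.2).1
  have hρ0 : 0 ≤ trRatio w.1.1 + trRatio w.1.2 + imRatio w.2 := by positivity
  have hsρ : s * (trRatio w.1.1 + trRatio w.1.2 + imRatio w.2) ≤ 1 / 4 := (mul_le_mul_of_nonneg_left hρ' hs.le).trans hR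
  rcases lt_or_gt_of_ne hz with hneg | hpos
  · exfalso
    refine hflip ⟨fun h => absurd h (not_mem_rescaledSigmaR_of_neg hA hJ hK hx hy hneg hs.le hsρ hrs), fun h => ?_⟩
    exact absurd ((mem_limSigma_iff r A w).1 h).2.2.2 (not_lt.2 hneg.le)
  by_cases hLx : 1 - s ^ 2 * ‖trPart w.1.1‖ ^ 2 ≤ ‖axPart w.1.1‖ ^ 2 ∧ ‖axPart w.1.1‖ ^ 2 < 1
  · exact Or.inl hLx
  by_cases hLy : 1 - s ^ 2 * ‖trPart w.1.2‖ ^ 2 ≤ ‖axPart w.1.2‖ ^ 2 ∧ ‖axPart w.1.2‖ ^ 2 < 1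
  · exact Or.inr (Or.inl hLy)
  by_cases hLz : 1 - s ^ 2 * ‖w.2.im‖ ^ 2 ≤ ‖(w.2.re : ℍ)‖ ^ 2 ∧ ‖(w.2.re : ℍ)‖ ^ 2 < 1
  · exact Or.inr (Or.inr (Or.inl hLz))
  right; right; right
  have hbx := dilate_ball_iff (ball_hyp_of_not_layer hLx)
  have hby := dilate_ball_iff (ball_hyp_of_not_layer hLy)
  have hbz := dilateIm_ball_iff (ball_hyp_of_not_layer hLz)
  have hshell := mem_shell_of_flip_taylor (r := r) hA hJ hK hs hx hy hpos (by linarith) hbx hby hbz hflip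
  have hδ : 8 * s * (trRatio w.1.1 + trRatio w.1.2 + imRatio w.2) ^ 2 ≤ 8 * s * R₀ ^ 2 := by
    have : (trRatio w.1.1 + trRatio w.1.2 + imRatio w.2) ^ 2 ≤ R₀ ^ 2 := pow_le_pow_left₀ hρ0 hρ' 2
    nlinarith
  exact ⟨limSigma_mono (by linarith) A hshell.1, fun h => hshell.2 (limSigma_mono (by linarith) A h)⟩

/-! ## §K Coordinates, and the flip set inside NULL ∪ (cuts ∩ (event ∪ limit)) ∪ SHELL -/

/-- `‖x̄‖² = x₀² + x_I²`. [folklore] -/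
theorem norm_axPart_sq (x : ℍ) : ‖axPart x‖ ^ 2 = x.re ^ 2 + x.imI ^ 2 := by
  rw [sq_norm_eq_sum_sq]; simp [axPart]

/-- `‖x_⊥‖² = x_J² + x_K²`. [folklore] -/
theorem norm_trPart_sq (x : ℍ) : ‖trPart x‖ ^ 2 = x.imJ ^ 2 + x.imK ^ 2 := by
  rw [sq_norm_eq_sum_sq]; simp [trPart]

/-- `‖(z₀ : ℍ)‖² = z₀²`. [folklore] -/
theorem norm_coe_re_sq (z : ℍ) : ‖(z.re : ℍ)‖ ^ 2 = z.re ^ 2 := by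
  rw [Quaternion.norm_coe, Real.norm_eq_abs, sq_abs]

/-- A large transverse ratio `a > T' ≥ 0` means a small axial part or a large transverse part: `‖x̄‖² < ε²` or `‖x_⊥‖² > T'²ε²` (`ε > 0`).
[folklore] -/
theorem trRatio_large {T' ε : ℝ} (hT : 0 ≤ T') {x : ℍ} (h : T' < trRatio x) :
    x.re ^ 2 + x.imI ^ 2 < ε ^ 2 ∨ T' ^ 2 * ε ^ 2 < x.imJ ^ 2 + x.imK ^ 2 := by
  by_cases hsm : ‖axPart x‖ ^ 2 < ε ^ 2
  · left; rwa [← norm_axPart_sq]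
  right
  have hge : ε ^ 2 ≤ ‖axPart x‖ ^ 2 := not_lt.1 hsm
  have hx0 : 0 < ‖axPart x‖ := by
    rcases (norm_nonneg (axPart x)).lt_or_eq with h0 | h0
    · exact h0
    · exfalso; rw [trRatio, ← h0, div_zero] at h; linarith
  rw [trRatio, lt_div_iff₀ hx0] at h
  rw [← norm_trPart_sq]
  have h1 : T' ^ 2 * ‖axPart x‖ ^ 2 ≤ ‖trPart x‖ ^ 2 := by
    have := pow_le_pow_left₀ (by positivity) h.le 2
    nlinarith
  have h2 : T' ^ 2 * ‖axPart x‖ ^ 2 < ‖trPart x‖ ^ 2 ∨ T' = 0 := by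
    by_cases hT0 : T' = 0
    · exact Or.inr hT0
    · left
      have hTp : 0 < T' := lt_of_le_of_ne hT (Ne.symm hT0)
      have hlt : (T' * ‖axPart x‖) ^ 2 < ‖trPart x‖ ^ 2 := by
        have := h; nlinarith [mul_pos hTp hx0, norm_nonneg (trPart x)]
      nlinarith
  rcases h2 with h2 | h2
  · calc T' ^ 2 * ε ^ 2 ≤ T' ^ 2 * ‖axPart x‖ ^ 2 := by gcongr
      _ < ‖trPart x‖ ^ 2 := h2
  · rw [h2]; simp only [ne_eq, OfNat.ofNat_ne_zero, not_false_eq_true, zero_pow, zero_mul]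
    have : 0 < ‖trPart x‖ := by have := h; nlinarith [norm_nonneg (trPart x), mul_nonneg hT hx0.le]
    positivity

/-- A large slaved ratio `c > T' ≥ 0` means `T'²z₀² < ‖ζ‖²`. [folklore] -/
theorem imRatio_large {T' : ℝ} (hT : 0 ≤ T') {z : ℍ} (h : T' < imRatio z) :
    T' ^ 2 * z.re ^ 2 < z.imI ^ 2 + z.imJ ^ 2 + z.imK ^ 2 := by
  have hz0 : 0 < ‖(z.re : ℍ)‖ := by
    rcases (norm_nonneg (z.re : ℍ)).lt_or_eq with h0 | h0
    · exact h0
    · exfalso; rw [imRatio, ← h0, div_zero] at h; linarith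
  rw [imRatio, lt_div_iff₀ hz0] at h
  rw [← norm_coe_re_sq, ← WeakCouplingRates.sq_norm_im]
  have hpos : 0 < ‖z.im‖ := by nlinarith [norm_nonneg z.im, mul_nonneg hT hz0.le]
  by_cases hT0 : T' = 0
  · rw [hT0]; simp only [ne_eq, OfNat.ofNat_ne_zero, not_false_eq_true, zero_pow, zero_mul]; positivity
  · have hTp : 0 < T' := lt_of_le_of_ne hT (Ne.symm hT0)
    nlinarith [mul_pos hTp hz0]

/-- ★★ **THE FLIP SET**: for an axial unit hub, `0 < s`, `rs < 1`, `0 ≤ R₀`, `sR₀ ≤ 1/4`, `ε > 0`, the symmetric difference of `rescaledSigmaR r s A`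
and `limSigma r A` is contained in NULL ∪ (the eight coordinate cuts ∩ (event ∪ limit)) ∪ the Taylor SHELL (`T' = R₀/3`). [folklore] -/
theorem flip_subset {r s R₀ ε : ℝ} {A : ℍ} (hA : ‖A‖ = 1) (hJ : A.imJ = 0) (hK : A.imK = 0) (hs : 0 < s) (hrs : r * s < 1)
    (hR0 : 0 ≤ R₀) (hR : s * R₀ ≤ 1 / 4) :
    (rescaledSigmaR r s A \ limSigma r A) ∪ (limSigma r A \ rescaledSigmaR r s A) ⊆
      {w : (ℍ × ℍ) × ℍ | axPart w.1.1 = 0 ∨ axPart w.1.2 = 0 ∨ w.2.re = 0} ∪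
      (({w : (ℍ × ℍ) × ℍ | w.1.1.re ^ 2 + w.1.1.imI ^ 2 < ε ^ 2} ∪ {w | (R₀ / 3) ^ 2 * ε ^ 2 < w.1.1.imJ ^ 2 + w.1.1.imK ^ 2} ∪
        {w | w.1.2.re ^ 2 + w.1.2.imI ^ 2 < ε ^ 2} ∪ {w | (R₀ / 3) ^ 2 * ε ^ 2 < w.1.2.imJ ^ 2 + w.1.2.imK ^ 2} ∪
        {w | (R₀ / 3) ^ 2 * w.2.re ^ 2 < w.2.imI ^ 2 + w.2.imJ ^ 2 + w.2.imK ^ 2} ∪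
        {w | 1 - s ^ 2 * (w.1.1.imJ ^ 2 + w.1.1.imK ^ 2) ≤ w.1.1.re ^ 2 + w.1.1.imI ^ 2 ∧ w.1.1.re ^ 2 + w.1.1.imI ^ 2 < 1} ∪
        {w | 1 - s ^ 2 * (w.1.2.imJ ^ 2 + w.1.2.imK ^ 2) ≤ w.1.2.re ^ 2 + w.1.2.imI ^ 2 ∧ w.1.2.re ^ 2 + w.1.2.imI ^ 2 < 1} ∪
        {w | 1 - s ^ 2 * (w.2.imI ^ 2 + w.2.imJ ^ 2 + w.2.imK ^ 2) ≤ w.2.re ^ 2 ∧ w.2.re ^ 2 < 1}) ∩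
        (rescaledSigmaR r s A ∪ limSigma r A)) ∪
      (limSigma (r + 8 * s * R₀ ^ 2) A \ limSigma (r - 8 * s * R₀ ^ 2) A) := by
  intro w hw
  have hRL : w ∈ rescaledSigmaR r s A ∪ limSigma r A := by
    rcases hw with h | h
    · exact Or.inl h.1
    · exact Or.inr h.1
  have hflip : ¬ (w ∈ rescaledSigmaR r s A ↔ w ∈ limSigma r A) := by
    rcases hw with h | h
    · exact fun hi => h.2 (hi.1 h.1)
    · exact fun hi => h.2 (hi.2 h.1)
  by_cases hx : axPart w.1.1 = 0
  · exact Or.inl (Or.inl (Or.inl hx))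
  by_cases hy : axPart w.1.2 = 0
  · exact Or.inl (Or.inl (Or.inr (Or.inl hy)))
  by_cases hz : w.2.re = 0
  · exact Or.inl (Or.inl (Or.inr (Or.inr hz)))
  rcases flip_cases hA hJ hK hs hrs hR hx hy hz hflip with hρ | hLx | hLy | hLz | hsh
  · -- large ratios: one of the three exceeds `R₀/3`
    left; right
    refine ⟨?_, hRL⟩
    have hT : 0 ≤ R₀ / 3 := by positivity
    by_cases ha : R₀ / 3 < trRatio w.1.1
    · rcases trRatio_large (ε := ε) hT ha with h | h
      · exact Or.inl (Or.inl (Or.inl (Or.inl (Or.inl (Or.inl (Or.inl h))))))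
      · exact Or.inl (Or.inl (Or.inl (Or.inl (Or.inl (Or.inl (Or.inr h))))))
    by_cases hb : R₀ / 3 < trRatio w.1.2
    · rcases trRatio_large (ε := ε) hT hb with h | h
      · exact Or.inl (Or.inl (Or.inl (Or.inl (Or.inl (Or.inr h)))))
      · exact Or.inl (Or.inl (Or.inl (Or.inl (Or.inr h))))
    have hc : R₀ / 3 < imRatio w.2 := by
      have h1 := not_lt.1 ha; have h2 := not_lt.1 hb; linarith
    exact Or.inl (Or.inl (Or.inl (Or.inr (imRatio_large hT hc))))
  · left; right
    refine ⟨Or.inl (Or.inl (Or.inr ?_)), hRL⟩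
    rw [norm_trPart_sq, norm_axPart_sq] at hLx; exact hLx
  · left; right
    refine ⟨Or.inl (Or.inr ?_), hRL⟩
    rw [norm_trPart_sq, norm_axPart_sq] at hLy; exact hLy
  · left; right
    refine ⟨Or.inr ?_, hRL⟩
    rw [WeakCouplingRates.sq_norm_im, norm_coe_re_sq] at hLz; exact hLz
  · exact Or.inr hsh

end Summit.QuantumFields.YangMills.Theorems.SwapVirialDeficit.ZeroModeSigma

end
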